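import Summits.AtomisticToContinuum.Crystallization.Theorems.PalmUnimodularRigidityCruxesToPalmRigidity
import Literature.MathematicalPhysics.StatisticalMechanics.BarlowStacking
import Literature.MathematicalPhysics.StatisticalMechanics.HaggStacking

/-!
# `StackingHinge` (stmt-AtomisticToContinuum-14993), line `Sketch`: stub `stub_allPointsOfRoot`

Transfer, part (c): EVERYTHING SHOWS AT THE ROOT.  For a point-stationary hard-core probability
law `P` on rooted configurations `μ = count|S`, `0 ∈ S` (Mecke / mass-transport form), if the ROOT
is SLP-good `P`-a.s. then `P`-a.s. EVERY point of the configuration is SLP-good.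

Proof.  Hard-core configurations are locally finite
(`count_restrict_floorNorm_preimage_lt_top`), so the Aldous–Lyons lemma in Mecke form
(`ae_forall_map_sub_of_ae`, no measurability of the event needed) transports the a.s. root
property to the configuration re-rooted at every one of its points, `θ_x (count|S)`,
`x ∈ S` (`count_restrict_singleton_ne_zero_iff`).  The re-rooted configuration is
`count|((· − x) '' S)` (`map_sub_count_restrict`), counting measures determine their sets, and
SLP-goodness is invariant under the translation `z ↦ z − x`: the nearest-neighbour distance is
unchanged (`Metric.infDist_image` for the isometry `z ↦ z − x`), and a rigid motion `g` matching
the translated window is conjugated to the rigid motion `z ↦ g z + x` matching the original one.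
All `[folklore]`.
-/

noncomputable section

namespace Summit.AtomisticToContinuum.Crystallization.Theorems.PricedHcpWindowsAllPointsOfRoot

open MeasureTheory Set Literature.Probability.Process
open Summit.AtomisticToContinuum.Crystallization.Theorems.PalmUnimodularRigidity
  (ae_forall_map_sub_of_ae count_restrict_floorNorm_preimage_lt_top)

/-! ## Translating a configuration to one of its points -/

section Count

variable {E : Type*} [MeasurableSpace E] [MeasurableSingletonClass E]

/-- A counting measure determines its set: `count|S = count|T → S = T`. [folklore] -/
theorem eq_of_count_restrict_eq {S T : Set E}
    (h : (Measure.count : Measure E).restrict S = (Measure.count : Measure E).restrict T) :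
    S = T := by
  ext y
  rw [← count_restrict_singleton_ne_zero_iff S y, h, count_restrict_singleton_ne_zero_iff]

end Count

section Translate

variable {E : Type*} [NormedAddCommGroup E]

/-- Puncturing the translate `S − x` at the origin is translating the punctured set `S ∖ {x}`.
[folklore] -/
theorem image_sub_sdiff_singleton_zero (S : Set E) (x : E) :
    ((fun z : E => z - x) '' S) \ {0} = (fun z : E => z - x) '' (S \ {x}) := by
  rw [Set.image_sdiff sub_left_injective, Set.image_singleton, sub_self]

/-- The nearest-neighbour distance of the origin in `S − x` is that of `x` in `S` (translations
are isometries). [folklore] -/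
theorem infDist_zero_image_sub (S : Set E) (x : E) :
    Metric.infDist (0 : E) (((fun z : E => z - x) '' S) \ {0}) = Metric.infDist x (S \ {x}) := by
  rw [image_sub_sdiff_singleton_zero]
  have h := Metric.infDist_image (Isometry.of_dist_eq fun a b => dist_sub_right a b x)
    (x := x) (t := S \ {x})
  simpa only [sub_self] using h

variable [NormedSpace ℝ E]

/-- **Two-way rigid matching is translation covariant.**  If the window of radius `r` about the
origin of the translated configuration `S − x` is two-way `t`-matched with the rigid image `g '' B`
of a template `B`, then the window of radius `r` about `x` of `S` itself is two-way `t`-matched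
with the rigid image of `B` under `z ↦ g z + x`. [folklore] -/
theorem rigidMatch_of_image_sub {S B : Set E} {x : E} {r t : ℝ}
    (h : ∃ g : E ≃ᵃⁱ[ℝ] E,
      (∀ y ∈ (fun z : E => z - x) '' S, dist (0 : E) y ≤ r → ∃ z ∈ B, dist y (g z) ≤ t) ∧
      (∀ z ∈ B, dist (0 : E) (g z) ≤ r → ∃ y ∈ (fun z : E => z - x) '' S, dist y (g z) ≤ t)) :
    ∃ g : E ≃ᵃⁱ[ℝ] E, (∀ y ∈ S, dist x y ≤ r → ∃ z ∈ B, dist y (g z) ≤ t) ∧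
      (∀ z ∈ B, dist x (g z) ≤ r → ∃ y ∈ S, dist y (g z) ≤ t) := by
  obtain ⟨g, h1, h2⟩ := h
  have hg' : ∀ z, (g.trans (AffineIsometryEquiv.vaddConst ℝ x)) z = g z + x := fun z => by
    simp only [AffineIsometryEquiv.coe_trans, Function.comp_apply,
      AffineIsometryEquiv.coe_vaddConst, vadd_eq_add]
  have hd : ∀ y z : E, dist y (g z + x) = dist (y - x) (g z) := fun y z => by
    rw [← dist_add_right (y - x) (g z) x, sub_add_cancel]
  refine ⟨g.trans (AffineIsometryEquiv.vaddConst ℝ x), fun y hy hxy => ?_, fun z hz hxz => ?_⟩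
  · have h0 : dist (0 : E) (y - x) ≤ r := by rwa [← sub_self x, dist_sub_right]
    obtain ⟨z, hz, hyz⟩ := h1 (y - x) (Set.mem_image_of_mem _ hy) h0
    refine ⟨z, hz, ?_⟩
    rw [hg', hd]
    exact hyz
  · rw [hg'] at hxz
    have h0 : dist (0 : E) (g z) ≤ r := by rwa [← dist_add_right 0 (g z) x, zero_add]
    obtain ⟨_, ⟨y, hy, rfl⟩, hyz⟩ := h2 z hz h0
    refine ⟨y, hy, ?_⟩
    rw [hg', hd]
    exact hyz

end Translate

/-! ## The stub -/

/-- **stub_allPointsOfRoot** (transfer, part c: EVERYTHING SHOWS AT THE ROOT).  For a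
point-stationary hard-core probability law `P` (Mecke / mass-transport form), if a.s. the root is
SLP-good then a.s. EVERY point is SLP-good: `ae_forall_map_sub_of_ae` (Aldous–Lyons Lemma 2.3 in
Mecke form; local finiteness from the hard core by `count_restrict_floorNorm_preimage_lt_top`),
the re-rooting identity `map_sub_count_restrict` (`θ_x count|S = count|((· − x) '' S)`),
injectivity of `S ↦ count|S`, and translation covariance of SLP-goodness
(`infDist_zero_image_sub`, `rigidMatch_of_image_sub`). [folklore] -/
theorem stub_allPointsOfRoot : ∀ δ : ℝ, 0 < δ → ∀ P : MeasureTheory.Measure (MeasureTheory.Measure (EuclideanSpace ℝ (Fin 3))), MeasureTheory.IsProbabilityMeasure P → (∀ᵐ μ ∂P, (∃ S : Set (EuclideanSpace ℝ (Fin 3)), (0 : EuclideanSpace ℝ (Fin 3)) ∈ S ∧ (∀ x ∈ S, ∀ y ∈ S, x ≠ y → δ ≤ dist x y) ∧ μ = (MeasureTheory.Measure.count : MeasureTheory.Measure (EuclideanSpace ℝ (Fin 3))).restrict S)) → (∀ g : MeasureTheory.Measure (EuclideanSpace ℝ (Fin 3)) → EuclideanSpace ℝ (Fin 3) → ENNReal,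 Measurable (Function.uncurry g) → ∫⁻ μ, ∫⁻ y, g μ y ∂μ ∂P = ∫⁻ μ, ∫⁻ y, g (MeasureTheory.Measure.map (fun z => z - y) μ) (-y) ∂μ ∂P) → (∀ᵐ μ ∂P, ∃ S : Set (EuclideanSpace ℝ (Fin 3)), μ = (MeasureTheory.Measure.count : MeasureTheory.Measure (EuclideanSpace ℝ (Fin 3))).restrict S ∧ (0 : EuclideanSpace ℝ (Fin 3)) ∈ S ∧ (∀ t r : ℝ, Metric.infDist (0 : EuclideanSpace ℝ (Fin 3)) (S \ {(0 : EuclideanSpace ℝ (Fin 3))}) / 6 < t → r < 3 * Metric.infDist (0 : EuclideanSpace ℝ (Fin 3)) (S \ {(0 : EuclideanSpace ℝ (Fin 3))}) → ∃ s : ℤ → ℤ, Literature.MathematicalPhysics.StatisticalMechanics.IsHaggSeq s ∧ ∃ g : EuclideanSpace ℝ (Fin 3) ≃ᵃⁱ[ℝ] EuclideanSpace ℝ (Fin 3), (∀ y ∈ S, dist (0 : EuclideanSpace ℝ (Fin 3)) y ≤ r → ∃ z ∈ Literature.MathematicalPhysics.StatisticalMechanics.barlowStacking (Metric.infDist (0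 : EuclideanSpace ℝ (Fin 3)) (S \ {(0 : EuclideanSpace ℝ (Fin 3))})) (Metric.infDist (0 : EuclideanSpace ℝ (Fin 3)) (S \ {(0 : EuclideanSpace ℝ (Fin 3))}) * Real.sqrt (2 / 3)) s, dist y (g z) ≤ t) ∧ (∀ z ∈ Literature.MathematicalPhysics.StatisticalMechanics.barlowStacking (Metric.infDist (0 : EuclideanSpace ℝ (Fin 3)) (S \ {(0 : EuclideanSpace ℝ (Fin 3))})) (Metric.infDist (0 : EuclideanSpace ℝ (Fin 3)) (S \ {(0 : EuclideanSpace ℝ (Fin 3))}) * Real.sqrt (2 / 3)) s, dist (0 : EuclideanSpace ℝ (Fin 3)) (g z) ≤ r → ∃ y ∈ S, dist y (g z) ≤ t))) → (∀ᵐ μ ∂P, ∃ S : Set (EuclideanSpace ℝ (Fin 3)), μ = (MeasureTheory.Measure.count : MeasureTheory.Measure (EuclideanSpace ℝ (Fin 3))).restrict S ∧ ∀ x ∈ S, (∀ t r : ℝ, Metric.infDist x (S \ {x}) / 6 < t → r < 3 * Metric.infDist x (S \ {x}) → ∃ s : ℤ → ℤ, Literature.MathematicalPhysics.StatisticalMechanics.IsHaggSeq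 s ∧ ∃ g : EuclideanSpace ℝ (Fin 3) ≃ᵃⁱ[ℝ] EuclideanSpace ℝ (Fin 3), (∀ y ∈ S, dist x y ≤ r → ∃ z ∈ Literature.MathematicalPhysics.StatisticalMechanics.barlowStacking (Metric.infDist x (S \ {x})) (Metric.infDist x (S \ {x}) * Real.sqrt (2 / 3)) s, dist y (g z) ≤ t) ∧ (∀ z ∈ Literature.MathematicalPhysics.StatisticalMechanics.barlowStacking (Metric.infDist x (S \ {x})) (Metric.infDist x (S \ {x}) * Real.sqrt (2 / 3)) s, dist x (g z) ≤ r → ∃ y ∈ S, dist y (g z) ≤ t))) := by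
  intro δ hδ P _hP hcore hstat hroot
  -- hard-core configurations are locally finite
  have hlf : ∀ᵐ μ ∂P, ∀ n : ℕ,
      μ ((fun z : EuclideanSpace ℝ (Fin 3) => ⌊‖z‖⌋₊) ⁻¹' {n}) < ⊤ := by
    filter_upwards [hcore] with μ hμ n
    obtain ⟨S, -, hsep, rfl⟩ := hμ
    exact count_restrict_floorNorm_preimage_lt_top hδ hsep n
  -- everything shows at the root: the re-rooted configuration has an SLP-good root, a.s.
  have hall := ae_forall_map_sub_of_ae hstat hlf hroot
  filter_upwards [hcore, hall] with μ hc ha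
  obtain ⟨S, -, -, rfl⟩ := hc
  refine ⟨S, rfl, fun x hx => ?_⟩
  obtain ⟨S', hS', -, hgood⟩ := ha x ((count_restrict_singleton_ne_zero_iff S x).2 hx)
  -- the re-rooted configuration is the counting measure of the translated set
  rw [map_sub_count_restrict] at hS'
  obtain rfl := eq_of_count_restrict_eq hS'
  -- translation covariance of SLP-goodness
  rw [infDist_zero_image_sub] at hgood
  intro t r ht hr
  obtain ⟨s, hs, hmatch⟩ := hgood t r ht hr
  exact ⟨s, hs, rigidMatch_of_image_sub hmatch⟩

end Summit.AtomisticToContinuum.Crystallization.Theorems.PricedHcpWindowsAllPointsOfRoot
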